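import Summits.QuantumFields.BalabanUV.T4Continuum.Support.NE7K1LinTwoRunKit

/-!
# NE7K1LinTwoRunUpper — row NE7 (node U5), candidate route HOM, path H1L, cell K1-lin(s): TWO-RUN COMPARISON AT
# `A = 0`, UPPER HALF — `⟨V, P_B^{Schur}V⟩ ≤ L²·⟨V, P_A V⟩` on run A's lattice (Schur complement ≤ block-constant trial)

Lineage `b2b-balaban-t4-ne7-p2` (CRUX PROVER NE7 #2), generation 64.  WHY.  `NE7K1LinSchurLineDerivRel` showed that the
η-UNIFORM `∂_s` letter of the interpolated two-cutoff line needs the TWO-RUN COMPARABILITY `c₁·P_A ≤ P_B^{Schur} ≤ C₁·P_A`,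
the `ℓ²`∕Schur-test currency of `NE7K1LinSchurLineDeriv` being mesh-dependent at U = 1.  THIS FILE proves the UPPER half at
`A = 0` for the objects of `NE7K1LinSchurLineU1` with the CRUDE constant `C₁ = L²` (kit: `NE7K1LinTwoRunKit`):

* `runB_isSymm`; `twoCutoffLine_one`: `twoCutoffLine … 1 = P_B^{Schur} = A₁ − BD⁻¹C`; `twoCutoffLine_zero`: `… 0 = runA`;
* `schurB_form_le_trial`: `⟨V, P_B^{Schur}V⟩ ≤ ⟨(V,0), runB(V,0)⟩` (completing the square; `D` invertible and `≥ 0` from the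
  coercivity of `runB`, floor `min(2,a)∕L^{d+1}`);
* **`schurB_form_le`**: `⟨V, P_B^{Schur}V⟩ ≤ L^{−(d+1)}⟨V∘blk, fineOpR (nL) a 0 R′ (V∘blk)⟩ ≤ L²·⟨V, runA V⟩` — Dirichlet part:
  each fine nearest-neighbour pair across a block face sits over a coarse nearest-neighbour pair, at most `L^{d+1}` of them per
  coarse pair (crude: `fine_nbr_sum_le` + `sum_comp_rblk`; the sharp count `L^d` would give `L`); averaging part: EQUALITY
  (`avgPart_eq` with `blockSum_coordT`).

HONEST FRAMING: Gaussian `A = 0`, finite regions, [folklore] over the tree's `B4Lower18.fineOpR_form`; the LOWER half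
(`c₁·P_A ≤ P_B^{Schur}`, (d+1)-dimensional Jensen) is NOT in this file; nothing printed asserted; no `sorry`.  FIXED FINITE T⁴,
rung (B)+1; NE7 NOT PRINTED ∕ NOT PROVED; spine 0∕9; NOT infinite volume, NOT mass gap, NOT Clay.  HONEST DEPENDENCY: continuum YM
on T⁴ ⇐ BetaPertH ∧ nine spine estimates (0/9 proved); BetaPertH ⇐ (D1) ∧ (D4) ∧ CAP+tail; G-an2-4 gates asym, D1 and NE2/3/4.
-/

noncomputable section

open Finset Matrix

namespace Summit.QuantumFields.BalabanUV.T4Continuum.NE7K1LinTwoRunUpper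

open Literature.MathematicalPhysics.QuantumFieldTheory.Balaban1983to89
open Literature.MathematicalPhysics.QuantumFieldTheory.Balaban1983to89.B4Reflection242
open Literature.MathematicalPhysics.QuantumFieldTheory.Balaban1983to89.B4BoxCov237
open Literature.MathematicalPhysics.QuantumFieldTheory.Balaban1983to89.B4Lower18
open Literature.MathematicalPhysics.QuantumFieldTheory.Balaban1983to89.B4Thm110ZeroBox (blk_blk)
open NE7K1LinSchurLineForm NE7K1LinSchurLineCoords NE7K1LinBlockCoords NE7K1LinSchurLineU1 NE7K1LinTwoRunKit

variable {d : ℕ}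

/-! ### §4 The upper comparison -/

section Upper

variable {n L : ℕ} [NeZero L] {R' : Finset (Fin (d + 1) → ℤ)}

/-- run B's operator in block coordinates is symmetric. [folklore] -/
theorem runB_isSymm (hR'L : IsBlockUnion L R') (n : ℕ) (a : ℝ) : (runB hR'L n a).IsSymm := by
  unfold Matrix.IsSymm runB
  rw [transpose_smul, transpose_mul, transpose_mul, transpose_transpose, (fineOpR_isSymm (n * L) a 0 R').eq,
    Matrix.mul_assoc]

/-- at `s = 1` the two-cutoff line IS the Schur complement `P_B^{Schur} = A₁ − BD⁻¹C`. [folklore] -/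
theorem twoCutoffLine_one (hR'L : IsBlockUnion L R') (n : ℕ) (a : ℝ) :
    twoCutoffLine hR'L n a 1 = (runB hR'L n a).toBlocks₁₁ -
      (runB hR'L n a).toBlocks₁₂ * ((runB hR'L n a).toBlocks₂₂)⁻¹ * (runB hR'L n a).toBlocks₂₁ := by
  simp only [twoCutoffLine, lineOpR, sub_self, zero_smul, one_smul, zero_add]

/-- at `s = 0` the two-cutoff line is run A's operator. [folklore] -/
theorem twoCutoffLine_zero (hR'L : IsBlockUnion L R') (n : ℕ) (a : ℝ) : twoCutoffLine hR'L n a 0 = runA n L a R' := by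
  simp only [twoCutoffLine, lineOpR, sub_zero, one_smul, zero_smul, add_zero]

/-- **THE SCHUR FORM OF RUN B IS BELOW THE BLOCK-CONSTANT TRIAL**: `⟨V,P_B^{Schur}V⟩ ≤ ⟨(V,0), runB (V,0)⟩` (`a > 0`, `R′` a
union of `nL`-blocks, `n ≥ 1`). [folklore] -/
theorem schurB_form_le_trial (hn : 1 ≤ n) (hR' : IsBlockUnion (n * L) R') {a : ℝ} (ha : 0 < a)
    (V : ↥(R'.image (blk L)) → ℝ) :
    V ⬝ᵥ (twoCutoffLine (isBlockUnion_fine hR') n a 1).mulVec V ≤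
      Sum.elim V 0 ⬝ᵥ (runB (isBlockUnion_fine hR') n a).mulVec (Sum.elim V 0) := by
  have hR'L : IsBlockUnion L R' := isBlockUnion_fine hR'
  have hnL : 1 ≤ n * L := Nat.one_le_iff_ne_zero.2 (Nat.mul_ne_zero (Nat.one_le_iff_ne_zero.1 hn) (NeZero.ne L))
  have hLpow : (0 : ℝ) < (L : ℝ) ^ (d + 1) := pow_pos (by exact_mod_cast (NeZero.one_le : 1 ≤ L)) _
  have hmin : 0 < min 2 a := lt_min (by norm_num) ha
  set H := runB hR'L n a with hH
  have hsymm : H.IsSymm := runB_isSymm hR'L n a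
  have hblocks := (Matrix.isSymm_fromBlocks_iff.1 (by rw [fromBlocks_toBlocks H]; exact hsymm))
  -- coercivity of `H` (floor `min(2,a)∕L^{d+1}`) ⇒ `D` invertible and `≥ 0`
  have hH₁ : ∀ u, min 2 a / (L : ℝ) ^ (d + 1) * (u ⬝ᵥ u) ≤ u ⬝ᵥ H.mulVec u := by
    intro u
    have h := coercive_congr (coordT hR'L) (fineOpR (n * L) a 0 R') (c := ((L : ℝ) ^ (d + 1))⁻¹) (σM := min 2 a)
      (cT := 1) (by positivity) hmin.le (fun φ => lower18_zero hnL ha.le hR' φ) (dot_le_coordT hR'L) u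
    have hσ' : ((L : ℝ) ^ (d + 1))⁻¹ * min 2 a * 1 = min 2 a / (L : ℝ) ^ (d + 1) := by field_simp
    rw [hσ'] at h
    exact h
  have hH₁' : ∀ u, min 2 a / (L : ℝ) ^ (d + 1) * (u ⬝ᵥ u) ≤
      u ⬝ᵥ (fromBlocks H.toBlocks₁₁ H.toBlocks₁₂ H.toBlocks₂₁ H.toBlocks₂₂).mulVec u := by
    rw [fromBlocks_toBlocks]; exact hH₁
  have hDu : IsUnit (H.toBlocks₂₂).det := isUnit_det_fineR _ _ _ _ (div_pos hmin hLpow) hH₁'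
  have hDpsd : ∀ φ, 0 ≤ φ ⬝ᵥ (H.toBlocks₂₂).mulVec φ := fun φ =>
    le_trans (mul_nonneg (div_pos hmin hLpow).le (by
      simp only [dotProduct]; exact Finset.sum_nonneg fun _ _ => mul_self_nonneg _))
      (NE7K1LinSchurLineDeriv.coercive_D _ _ _ _ hH₁' φ)
  have h := schur_form_le H.toBlocks₁₁ H.toBlocks₁₂ H.toBlocks₂₁ H.toBlocks₂₂ hblocks.2.1 hblocks.2.2.2 hDu hDpsd V 0
  rw [fromBlocks_toBlocks] at h
  rw [twoCutoffLine_one]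
  exact h

/-- **TWO-RUN COMPARISON AT `A = 0`, UPPER HALF**: `⟨V, P_B^{Schur}V⟩ ≤ L²·⟨V, P_A V⟩` for every `V` on run A's lattice
(`a > 0`, `n ≥ 1`, `R′` a union of `nL`-blocks). [folklore] -/
theorem schurB_form_le (hn : 1 ≤ n) (hR' : IsBlockUnion (n * L) R') {a : ℝ} (ha : 0 < a)
    (V : ↥(R'.image (blk L)) → ℝ) :
    V ⬝ᵥ (twoCutoffLine (isBlockUnion_fine hR') n a 1).mulVec V ≤ (L : ℝ) ^ 2 * (V ⬝ᵥ (runA n L a R').mulVec V) := by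
  classical
  have hL : 1 ≤ L := NeZero.one_le
  have hR'L : IsBlockUnion L R' := isBlockUnion_fine hR'
  have hRc : IsBlockUnion n (R'.image (blk L)) := isBlockUnion_coarse hL hR'
  have hnL : 1 ≤ n * L := Nat.one_le_iff_ne_zero.2 (Nat.mul_ne_zero (Nat.one_le_iff_ne_zero.1 hn) (NeZero.ne L))
  have hLpow : (0 : ℝ) < (L : ℝ) ^ (d + 1) := pow_pos (by exact_mod_cast hL) _
  have hL1 : (1 : ℝ) ≤ (L : ℝ) := by exact_mod_cast hL
  refine (schurB_form_le_trial hn hR' ha V).trans ?_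
  -- the trial's form: `L^{−(d+1)}·⟨V∘blk, M (V∘blk)⟩`
  have hL0 : (L : ℝ) ≠ 0 := by exact_mod_cast (NeZero.ne L)
  rw [runB, dot_congr_mulVec, coordT_inl hR'L V, fineOpR_form hnL hR' a 0, runA, fineOpR_form hn hRc a 0, zero_mul, add_zero,
    zero_mul, add_zero, mul_add]
  -- averaging parts are EQUAL; Dirichlet parts compare with the crude factor `L^{d+1}`
  have havg := avgPart_eq hn a (fun x' => V (rblk L R' x')) V (fun b => by
    have := blockSum_coordT hR'L (Sum.elim V 0) b
    rw [coordT_inl hR'L V] at this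
    exact this)
  have hdir : ∑ x' : ↥R', ∑ y' : ↥R', (if y'.1 ∈ nbrs x'.1 then (V (rblk L R' x') - V (rblk L R' y')) ^ 2 else 0) ≤
      (L : ℝ) ^ (d + 1) * ∑ x : ↥(R'.image (blk L)), ∑ y : ↥(R'.image (blk L)),
        (if y.1 ∈ nbrs x.1 then (V x - V y) ^ 2 else 0) := by
    rw [← sum_comp_rblk hR'L (fun b => ∑ y : ↥(R'.image (blk L)), (if y.1 ∈ nbrs b.1 then (V b - V y) ^ 2 else 0))]
    exact Finset.sum_le_sum fun x' _ => fine_nbr_sum_le V x'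
  have hcoarse_nn : 0 ≤ ∑ x : ↥(R'.image (blk L)), ∑ y : ↥(R'.image (blk L)),
      (if y.1 ∈ nbrs x.1 then (V x - V y) ^ 2 else (0 : ℝ)) :=
    Finset.sum_nonneg fun _ _ => Finset.sum_nonneg fun _ _ => by split_ifs <;> positivity
  have havg_nn : 0 ≤ a * ((n : ℝ) ^ (d + 1))⁻¹ * ∑ B₀ : ↥((R'.image (blk L)).image (blk n)),
      (∑ b ∈ Finset.univ.filter (fun b => rblk n (R'.image (blk L)) b = B₀), V b) ^ 2 := by
    have : 0 ≤ ∑ B₀ : ↥((R'.image (blk L)).image (blk n)),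
        (∑ b ∈ Finset.univ.filter (fun b => rblk n (R'.image (blk L)) b = B₀), V b) ^ 2 :=
      Finset.sum_nonneg fun _ _ => sq_nonneg _
    positivity
  rw [havg, mul_add]
  have hdir' : ((L : ℝ) ^ (d + 1))⁻¹ * (((n * L : ℕ) : ℝ) ^ 2 / 2 *
      ∑ x' : ↥R', ∑ y' : ↥R', (if y'.1 ∈ nbrs x'.1 then (V (rblk L R' x') - V (rblk L R' y')) ^ 2 else 0)) ≤
      (L : ℝ) ^ 2 * ((n : ℝ) ^ 2 / 2 * ∑ x : ↥(R'.image (blk L)), ∑ y : ↥(R'.image (blk L)),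
        (if y.1 ∈ nbrs x.1 then (V x - V y) ^ 2 else 0)) := by
    have h1 := mul_le_mul_of_nonneg_left hdir (show (0 : ℝ) ≤ ((L : ℝ) ^ (d + 1))⁻¹ * (((n * L : ℕ) : ℝ) ^ 2 / 2) by
      positivity)
    have e : ((L : ℝ) ^ (d + 1))⁻¹ * (((n * L : ℕ) : ℝ) ^ 2 / 2) * ((L : ℝ) ^ (d + 1) *
        ∑ x : ↥(R'.image (blk L)), ∑ y : ↥(R'.image (blk L)), (if y.1 ∈ nbrs x.1 then (V x - V y) ^ 2 else 0)) =
        (L : ℝ) ^ 2 * ((n : ℝ) ^ 2 / 2 * ∑ x : ↥(R'.image (blk L)), ∑ y : ↥(R'.image (blk L)),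
          (if y.1 ∈ nbrs x.1 then (V x - V y) ^ 2 else 0)) := by
      push_cast
      field_simp
    rw [← e]
    linarith [h1]
  have hA := le_mul_of_one_le_left havg_nn (show (1 : ℝ) ≤ (L : ℝ) ^ 2 by nlinarith)
  linarith [hdir', hA]

end Upper

end Summit.QuantumFields.BalabanUV.T4Continuum.NE7K1LinTwoRunUpper
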